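import Mathlib
import Summits.NavierStokesRegularity.NavierStokesRegularity.Theorems.TaoLadderRungTwoBreakOneShiftWindowCert
import Summits.NavierStokesRegularity.NavierStokesRegularity.Theorems.TaoLadderRungTwoBreakOneShiftTubeDefs
import HarnessLib

/-!
# The one-shift window system, V: the two KRAWCZYK clauses (`hwinIn`, `hWedge`) of the certificate side reduced to
# three interval-style hypotheses on the preconditioned residual (cell harvest/h2-tao-ladder, seat p2;
# rung1/RUNG1-P2G10-REPORT.md §43; support for K1(1) = `NoSurvivingDSSOne`, stmt-NavierStokesRegularity-20205)

MODEL lattice ODEs only (Tao 2016 §4 normal form on Tao's shift set `S`); nothing here is a statement about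
the Navier–Stokes equations; no item is closed; nothing numerical is proved.

For the CONSTRUCTED window certificate `F.windowCertOfMatrix … C hC` (part IV) the raw window output of the
one-shift map is, in scaled coordinates, `ξ ↦ clamp(ξ) − P(u)` with `P(u) = S⁻¹ C G_T(ŷ + Sξ, τ̂ + r_τ τ̃)` the
SCALED PRECONDITIONED RESIDUAL (`precondResidual`; `S` = the box radii / flight-time radius). The two Krawczyk
clauses of the certificate side (`hwinIn`: the output lies in the unit box; `hWedge`: it is `Z`-Lipschitz in the
point plus `S_b`, `S_e` times the edge-input distances) then follow — by splitting a pair of admissible points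
through the HYBRID point (window coordinates of one, tails of the other; `AdmLip` is a product condition) — from:

* (K1) contraction in the point at frozen tails: `|(ξ_u − ξ_v) − (P u − P v)|_∞ ≤ Z · dist(u, v)` whenever `u, v`
  have the same tails (what an interval bound `‖I − S⁻¹C·[DG]·S‖_∞ ≤ Z` over the box delivers);
* (K2) Lipschitz in the tails at frozen point: `|P u − P v|_∞ ≤ S_b B + S_e E` whenever `u, v` have the same
  window coordinates and their wake / top edge tails differ by at most `B` / `E` (the engine's sensitivities);
* (K3) the centre residual over the tails: `|P u|_∞ ≤ Y` whenever `ξ_u = 0`; and `Y + Z ≤ 1`.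

`rawWindow_windowCertOfMatrix` (the unfolding), `krawczyk_winIn` (K1+K3 ⇒ `hwinIn`), `krawczyk_wedge`
(K1+K2 ⇒ `hWedge`). This is the format in which a kernel replay (interval Jacobian of the residual over the box +
finite-dimensional interval linear algebra, cf. `Literature/Analysis/ValidatedNumerics/CodeListKrawczyk*`)
will discharge the two clauses; (K1)–(K3) are HYPOTHESES here.
-/

noncomputable section

-- the sub-problem namespace repeats the summit name by design (D-0017)
set_option linter.dupNamespace false

namespace Summit.NavierStokesRegularity.NavierStokesRegularity.Theorems

namespace DSSOneShift

open Set Metric Literature.Analysis.FluidPDE Literature.Analysis.FluidPDE.TaoCascade CertificateGlueOn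

variable {m : ℕ}

namespace OneShiftFrame

variable (F : OneShiftFrame m)

/-! ### The scaled preconditioned residual -/

/-- **The scaled preconditioned residual** `P(u) = S⁻¹ · C · G_T(y, τ)` of a point of trajectory space (pre-clamped
data; `S` = diag(box radii, flight-time radius)). [cite: Tao2016AveragedNS, §5.3; cell vocabulary, harvest/h2-tao-ladder rung1/STAGE2-LEMMA.md §2 (N = x − C·G, scaled coordinates)] -/
def precondResidual (ε₀ : ℝ) (α : Fin m → Fin m → Fin m → ℤ × ℤ × ℤ → ℝ) (C : F.WState × ℝ → F.WState × ℝ)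
    (u : F.Space) : F.WState × ℝ :=
  (fun i j => (C (F.residual ε₀ α (F.preclampTail u) (F.preclampY u, F.preclampTau u))).1 i j /
      F.a i ((j : ℕ) : ℤ),
    (C (F.residual ε₀ α (F.preclampTail u) (F.preclampY u, F.preclampTau u))).2 / F.rτ)

/-- The pre-clamped window start at a window shell, in `Fin W` indexing. [folklore] -/
theorem preclampY_natCast (u : F.Space) (i : Fin m) (j : Fin F.W) :
    F.preclampY u i ((j : ℕ) : ℤ) = F.yc i ((j : ℕ) : ℤ) + F.a i ((j : ℕ) : ℤ) * clampUnit (u.1 i j) := by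
  have hj : F.InWindow ((j : ℕ) : ℤ) := F.inWindow_natCast j
  simp [preclampY, dif_pos hj]

/-- **Unfolding the raw window output of the constructed certificate**: window coordinates
`clamp(ξ) − P(u)`, flight-time coordinate `clamp(τ̃) − P(u)_τ`. [cite: Tao2016AveragedNS, §5.3; cell vocabulary, harvest/h2-tao-ladder rung1/STAGE2-LEMMA.md §2] -/
theorem rawWindow_windowCertOfMatrix {ε₀ : ℝ} (hε : 0 ≤ ε₀) (hW : 0 < F.W)
    {α : Fin m → Fin m → Fin m → ℤ × ℤ × ℤ → ℝ} (hα : IsCancellingCoeff α)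
    (hEb : ∀ i, |F.tubeC i (-1)| + F.tubeR (-1) ≤ F.Eb) (hEt : ∀ i, |F.tubeC i F.W| + F.tubeR F.W ≤ F.Et)
    (C : F.WState × ℝ → F.WState × ℝ) (hC : ∀ r, C r = 0 → r = 0) (u : F.Space) :
    F.rawWindow (F.windowCertOfMatrix hε hW hα hEb hEt C hC) u =
      (fun i j => clampUnit (u.1 i j) - (F.precondResidual ε₀ α C u).1 i j,
        clampUnit u.2.1 - (F.precondResidual ε₀ α C u).2) := by
  have hr := F.rτ_pos
  refine Prod.ext ?_ ?_
  · funext i j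
    have hj : F.InWindow ((j : ℕ) : ℤ) := F.inWindow_natCast j
    have ha := F.a_pos i ((j : ℕ) : ℤ)
    simp only [rawWindow, windowCertOfMatrix_Nmap, krawczyk, dif_pos hj, F.widx_natCast, precondResidual,
      F.preclampY_natCast]
    field_simp
    ring
  · simp only [rawWindow, windowCertOfMatrix_Nmap, krawczyk, precondResidual, preclampTau]
    field_simp
    ring

/-! ### Hybrid points -/

/-- The HYBRID point: window coordinates and flight time of `v`, tails of `u`. [folklore] -/
def hybrid (u v : F.Space) : F.Space := (v.1, v.2.1, u.2.2)

/-- The hybrid point has the tails of `u`. [folklore] -/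
theorem decodeTail_hybrid (u v : F.Space) : F.decodeTail (F.hybrid u v) = F.decodeTail u := rfl

/-- `AdmLip` is a product condition: the hybrid of two admissible points is admissible. [folklore] -/
theorem admLip_hybrid {R : ℤ → ℝ} {u v : F.Space} (hu : F.AdmLip R u) (hv : F.AdmLip R v) :
    F.AdmLip R (F.hybrid u v) :=
  ⟨⟨hv.1.1, hv.1.2.1, hu.1.2.2.1, hu.1.2.2.2.1, hu.1.2.2.2.2⟩, hu.2⟩

/-- The hybrid point is no farther from `u` than `v` is. [folklore] -/
theorem dist_hybrid_le (u v : F.Space) : dist u (F.hybrid u v) ≤ dist u v := by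
  rw [Prod.dist_eq, Prod.dist_eq, Prod.dist_eq, Prod.dist_eq]
  simp only [hybrid, dist_self]
  refine max_le (le_max_left _ _) ((max_le (le_trans (le_max_left _ _) (le_max_right _ _)) ?_))
  exact le_trans dist_nonneg (le_max_left _ _)

/-- A window coordinate difference is bounded by the distance in trajectory space. [folklore] -/
theorem abs_fst_sub_le_dist (u v : F.Space) (i : Fin m) (j : Fin F.W) : |u.1 i j - v.1 i j| ≤ dist u v := by
  rw [← Real.dist_eq, Prod.dist_eq]
  exact ((dist_le_pi_dist _ _ j).trans (dist_le_pi_dist _ _ i)).trans (le_max_left _ _)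

/-- The flight-time coordinate difference is bounded by the distance in trajectory space. [folklore] -/
theorem abs_snd_sub_le_dist (u v : F.Space) : |u.2.1 - v.2.1| ≤ dist u v := by
  rw [← Real.dist_eq, Prod.dist_eq, Prod.dist_eq]
  exact (le_max_left _ _).trans (le_max_right _ _)

/-! ### The two Krawczyk clauses from (K1)–(K3) -/

section Krawczyk

variable {ε₀ : ℝ} (hε : 0 ≤ ε₀) (hW : 0 < F.W) {α : Fin m → Fin m → Fin m → ℤ × ℤ × ℤ → ℝ}
  (hα : IsCancellingCoeff α) (hEb : ∀ i, |F.tubeC i (-1)| + F.tubeR (-1) ≤ F.Eb)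
  (hEt : ∀ i, |F.tubeC i F.W| + F.tubeR F.W ≤ F.Et) (C : F.WState × ℝ → F.WState × ℝ)
  (hC : ∀ r, C r = 0 → r = 0) (R : ℤ → ℝ)

/-- **KRAWCZYK INCLUSION from (K1) + (K3).** If the scaled preconditioned residual contracts in the point at frozen
tails with constant `Z` (K1) and is bounded by `Y` at the box centre for all admissible tails (K3), with
`Y + Z ≤ 1`, then the raw window output of every `AdmLip` point lies in the unit box — the clause `hwinIn` of the
certificate side for the constructed certificate. [cite: Tao2016AveragedNS, §5.3; cell vocabulary, harvest/h2-tao-ladder rung1/STAGE2-LEMMA.md §2–§3 ((H-win): ‖C G(x̂)‖ + ‖I − C DG‖ ≤ 1), rung1/RUNG1-P2G10-REPORT.md §43] -/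
theorem krawczyk_winIn {Z Y : ℝ} (hZ : 0 ≤ Z) (hYZ : Y + Z ≤ 1)
    (K1 : ∀ u v, F.AdmLip R u → F.AdmLip R v → u.2.2 = v.2.2 →
      (∀ i j, |(u.1 i j - v.1 i j) -
        ((F.precondResidual ε₀ α C u).1 i j - (F.precondResidual ε₀ α C v).1 i j)| ≤ Z * dist u v) ∧
      |(u.2.1 - v.2.1) - ((F.precondResidual ε₀ α C u).2 - (F.precondResidual ε₀ α C v).2)| ≤ Z * dist u v)
    (K3 : ∀ u, F.AdmLip R u → u.1 = 0 → u.2.1 = 0 →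
      (∀ i j, |(F.precondResidual ε₀ α C u).1 i j| ≤ Y) ∧ |(F.precondResidual ε₀ α C u).2| ≤ Y)
    (u : F.Space) (hu : F.AdmLip R u) :
    (∀ i k, |(F.rawWindow (F.windowCertOfMatrix hε hW hα hEb hEt C hC) u).1 i k| ≤ 1) ∧
      |(F.rawWindow (F.windowCertOfMatrix hε hW hα hEb hEt C hC) u).2| ≤ 1 := by
  -- the centre point with the tails of `u`
  set w : F.Space := ((0 : F.WState), (0 : ℝ), u.2.2) with hw
  have hw_adm : F.AdmLip R w := by
    refine ⟨⟨fun i k => by simp [hw], by simp [hw], hu.1.2.2.1, hu.1.2.2.2.1, hu.1.2.2.2.2⟩, hu.2⟩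
  have hdist : dist u w ≤ 1 := by
    rw [Prod.dist_eq, Prod.dist_eq]
    refine max_le ?_ (max_le ?_ ?_)
    · refine (dist_pi_le_iff zero_le_one).2 fun i => (dist_pi_le_iff zero_le_one).2 fun k => ?_
      rw [Real.dist_eq]; simpa [hw] using hu.1.1 i k
    · rw [Real.dist_eq]; simpa [hw] using hu.1.2.1
    · simp [hw]
  obtain ⟨K1a, K1b⟩ := K1 u w hu hw_adm rfl
  obtain ⟨K3a, K3b⟩ := K3 w hw_adm rfl rfl
  rw [F.rawWindow_windowCertOfMatrix hε hW hα hEb hEt C hC u]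
  refine ⟨fun i k => ?_, ?_⟩
  · have h1 := K1a i k
    have h3 := K3a i k
    simp only [hw, Pi.zero_apply, sub_zero] at h1
    dsimp only
    rw [clampUnit_of_abs_le (hu.1.1 i k)]
    have e : u.1 i k - (F.precondResidual ε₀ α C u).1 i k =
        (u.1 i k - ((F.precondResidual ε₀ α C u).1 i k - (F.precondResidual ε₀ α C w).1 i k)) -
          (F.precondResidual ε₀ α C w).1 i k := by ring
    rw [e]
    refine (abs_sub _ _).trans ?_
    nlinarith [mul_le_mul_of_nonneg_left hdist hZ]
  · have h1 := K1b
    simp only [hw, sub_zero] at h1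
    show |clampUnit u.2.1 - (F.precondResidual ε₀ α C u).2| ≤ 1
    rw [clampUnit_of_abs_le hu.1.2.1]
    have e : u.2.1 - (F.precondResidual ε₀ α C u).2 =
        (u.2.1 - ((F.precondResidual ε₀ α C u).2 - (F.precondResidual ε₀ α C w).2)) -
          (F.precondResidual ε₀ α C w).2 := by ring
    rw [e]
    refine (abs_sub _ _).trans ?_
    nlinarith [mul_le_mul_of_nonneg_left hdist hZ]

/-- **KRAWCZYK LIPSCHITZ BOUND (edge form) from (K1) + (K2).** If the scaled preconditioned residual contracts in the
point at frozen tails with constant `Z` (K1) and is Lipschitz in the tails at frozen point with constants `S_b`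
(wake edge) and `S_e` (top edge) (K2), then the raw window output satisfies the clause `hWedge` of the certificate
side for the constructed certificate: `dist ≤ Z·dist(u,v) + S_b·B + S_e·E`.
[cite: Tao2016AveragedNS, §5.3; cell vocabulary, harvest/h2-tao-ladder rung1/STAGE3-BANACH.md §2 ((H-lip) window block), rung1/RUNG1-P2G10-REPORT.md §43] -/
theorem krawczyk_wedge {Z Sb Se : ℝ} (hZ : 0 ≤ Z)
    (K1 : ∀ u v, F.AdmLip R u → F.AdmLip R v → u.2.2 = v.2.2 →
      (∀ i j, |(u.1 i j - v.1 i j) -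
        ((F.precondResidual ε₀ α C u).1 i j - (F.precondResidual ε₀ α C v).1 i j)| ≤ Z * dist u v) ∧
      |(u.2.1 - v.2.1) - ((F.precondResidual ε₀ α C u).2 - (F.precondResidual ε₀ α C v).2)| ≤ Z * dist u v)
    (K2 : ∀ u v, F.AdmLip R u → F.AdmLip R v → u.1 = v.1 → u.2.1 = v.2.1 → ∀ B E : ℝ,
      (∀ i, ∀ t ∈ Icc 0 F.τhi, |F.decodeTail u i (-1) t - F.decodeTail v i (-1) t| ≤ B) →
      (∀ i, ∀ t ∈ Icc 0 F.τhi, |F.decodeTail u i F.W t - F.decodeTail v i F.W t| ≤ E) →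
      (∀ i j, |(F.precondResidual ε₀ α C u).1 i j - (F.precondResidual ε₀ α C v).1 i j| ≤ Sb * B + Se * E) ∧
        |(F.precondResidual ε₀ α C u).2 - (F.precondResidual ε₀ α C v).2| ≤ Sb * B + Se * E)
    (u v : F.Space) (hu : F.AdmLip R u) (hv : F.AdmLip R v) (B E : ℝ)
    (hB : ∀ i, ∀ t ∈ Icc 0 F.τhi, |F.decodeTail u i (-1) t - F.decodeTail v i (-1) t| ≤ B)
    (hE : ∀ i, ∀ t ∈ Icc 0 F.τhi, |F.decodeTail u i F.W t - F.decodeTail v i F.W t| ≤ E) :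
    dist (F.rawWindow (F.windowCertOfMatrix hε hW hα hEb hEt C hC) u)
        (F.rawWindow (F.windowCertOfMatrix hε hW hα hEb hEt C hC) v) ≤
      Z * dist u v + Sb * B + Se * E := by
  -- the hybrid point: window data of `v`, tails of `u`
  have hw_adm := F.admLip_hybrid hu hv
  obtain ⟨K1a, K1b⟩ := K1 u (F.hybrid u v) hu hw_adm rfl
  obtain ⟨K2a, K2b⟩ := K2 (F.hybrid u v) v hw_adm hv rfl rfl B E
    (fun i t ht => by rw [F.decodeTail_hybrid]; exact hB i t ht)
    (fun i t ht => by rw [F.decodeTail_hybrid]; exact hE i t ht)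
  have hdw := F.dist_hybrid_le u v
  have hBE : 0 ≤ Sb * B + Se * E := (abs_nonneg _).trans K2b
  have htot : 0 ≤ Z * dist u v + Sb * B + Se * E := by
    have := mul_nonneg hZ (dist_nonneg (x := u) (y := v)); linarith
  rw [F.rawWindow_windowCertOfMatrix hε hW hα hEb hEt C hC u, F.rawWindow_windowCertOfMatrix hε hW hα hEb hEt C hC v,
    Prod.dist_eq]
  refine max_le ?_ ?_
  · refine (dist_pi_le_iff htot).2 fun i => (dist_pi_le_iff htot).2 fun k => ?_
    dsimp only
    rw [Real.dist_eq, clampUnit_of_abs_le (hu.1.1 i k), clampUnit_of_abs_le (hv.1.1 i k)]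
    have h1 := K1a i k
    have h2 := K2a i k
    have e : u.1 i k - (F.precondResidual ε₀ α C u).1 i k - (v.1 i k - (F.precondResidual ε₀ α C v).1 i k) =
        ((u.1 i k - (F.hybrid u v).1 i k) -
          ((F.precondResidual ε₀ α C u).1 i k - (F.precondResidual ε₀ α C (F.hybrid u v)).1 i k)) -
        ((F.precondResidual ε₀ α C (F.hybrid u v)).1 i k - (F.precondResidual ε₀ α C v).1 i k) := by
      simp only [hybrid]; ring
    rw [e]
    refine (abs_sub _ _).trans ?_
    nlinarith [mul_le_mul_of_nonneg_left hdw hZ]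
  · show dist (clampUnit u.2.1 - (F.precondResidual ε₀ α C u).2) (clampUnit v.2.1 - (F.precondResidual ε₀ α C v).2) ≤ _
    rw [Real.dist_eq, clampUnit_of_abs_le hu.1.2.1, clampUnit_of_abs_le hv.1.2.1]
    have e2 : u.2.1 - (F.precondResidual ε₀ α C u).2 - (v.2.1 - (F.precondResidual ε₀ α C v).2) =
        ((u.2.1 - (F.hybrid u v).2.1) -
          ((F.precondResidual ε₀ α C u).2 - (F.precondResidual ε₀ α C (F.hybrid u v)).2)) -
        ((F.precondResidual ε₀ α C (F.hybrid u v)).2 - (F.precondResidual ε₀ α C v).2) := by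
      simp only [hybrid]; ring
    rw [e2]
    refine (abs_sub _ _).trans ?_
    nlinarith [mul_le_mul_of_nonneg_left hdw hZ]

end Krawczyk

end OneShiftFrame

end DSSOneShift

end Summit.NavierStokesRegularity.NavierStokesRegularity.Theorems
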